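import Summits.Ventures.CertifiedQuantumChemistry.Rows.SpinSectors
import Literature.MathematicalPhysics.QuantumLattice.HubbardModelThermodynamicLimitProofs
import Literature.MathematicalPhysics.QuantumLattice.HubbardModelParticleHoleProofs
import HarnessLib

/-!
# REVIEW-RUNBOOK sanity lemmas — the variational set behind `groundEnergy F.hamiltonian (a + b)` is NON-EMPTY and bounded below
# under exactly the hypotheses of `Model.groundEnergy_le_energy` (client `pub-qchem` of the ops review-runbook generator; §2 card `groundEnergy`)

`Literature.MathematicalPhysics.QuantumLattice.groundEnergy H N = sInf {E | ∃ ψ, IsNParticle N ψ ∧ ‖ψ‖² = 1 ∧ E = ⟨ψ, Hψ⟩.re}`;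
over `ℝ` the `sInf` is the default `0` when the set is EMPTY — which happens exactly when `N` exceeds the number of spin orbitals
(Pauli).  The tree's settling rows (`groundEnergySet_nonempty`, `groundEnergySet_bddBelow`) are stated for a general orbital type `κ`
under `N ≤ |κ|`; the `pub-qchem` statements apply the definition to a rational model `F : Model k` on `Orb (Fin k)` (`2k` spin
orbitals) in the sector `N = a + b` with `a ≤ k`, `b ≤ k` — so `N ≤ 2k = |Orb (Fin k)|` and the rows apply.  This file says so in the
statements' own hypotheses, so the S-cards can read the side fact as MET BY THE STATEMENT.

Review evidence only (topic module of the venture, closes no item); no definitions, no `sorry`, standard axioms.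
-/

namespace Summit.Ventures.CertifiedQuantumChemistry.Runbook

open Literature.MathematicalPhysics.QuantumLattice Literature.MathematicalPhysics.QuantumLattice.ThermodynamicLimit

/-- A realised sector fits: `a ≤ k`, `b ≤ k` ⇒ `a + b ≤ |Orb (Fin k)| = 2k`. [folklore] -/
theorem sector_le_card_orb {k a b : ℕ} (ha : a ≤ k) (hb : b ≤ k) : a + b ≤ Fintype.card (Orb (Fin k)) := by
  rw [card_orb, Fintype.card_fin]; omega

/-- (c) **The variational set of `groundEnergy F.hamiltonian (a + b)` is NON-EMPTY** for every model `F : Model k` and every realised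
sector `a, b ≤ k` (an `(a+b)`-electron basis determinant exists among `2k` spin orbitals): under the hypotheses of
`Model.groundEnergy_le_energy` the `sInf` is taken over a non-empty set. [folklore] -/
theorem groundEnergySet_nonempty_model {k : ℕ} (F : Model k) {a b : ℕ} (ha : a ≤ k) (hb : b ≤ k) :
    {E : ℝ | ∃ ψ : Fock (Orb (Fin k)), IsNParticle (a + b) ψ ∧ star ψ ⬝ᵥ ψ = 1 ∧ E = (expect F.hamiltonian ψ).re}.Nonempty :=
  groundEnergySet_nonempty F.hamiltonian (sector_le_card_orb ha hb)

/-- (c) … and BOUNDED BELOW (for every `N`; a finite-dimensional Hermitian form). [folklore] -/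
theorem groundEnergySet_bddBelow_model {k : ℕ} (F : Model k) (N : ℕ) :
    BddBelow {E : ℝ | ∃ ψ : Fock (Orb (Fin k)), IsNParticle N ψ ∧ star ψ ⬝ᵥ ψ = 1 ∧ E = (expect F.hamiltonian ψ).re} :=
  groundEnergySet_bddBelow F.hamiltonian N

/-- Both at once, in the generator's printed shape (`BddBelow S ∧ S.Nonempty`), under the statement's hypotheses `a ≤ k`, `b ≤ k`:
`groundEnergy F.hamiltonian (a + b)` is the genuine infimum of the sector's energies. [folklore] -/
theorem groundEnergySet_bddBelow_nonempty_model {k : ℕ} (F : Model k) {a b : ℕ} (ha : a ≤ k) (hb : b ≤ k) :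
    BddBelow {E : ℝ | ∃ ψ : Fock (Orb (Fin k)), IsNParticle (a + b) ψ ∧ star ψ ⬝ᵥ ψ = 1 ∧ E = (expect F.hamiltonian ψ).re} ∧
      {E : ℝ | ∃ ψ : Fock (Orb (Fin k)), IsNParticle (a + b) ψ ∧ star ψ ⬝ᵥ ψ = 1 ∧ E = (expect F.hamiltonian ψ).re}.Nonempty :=
  ⟨groundEnergySet_bddBelow_model F (a + b), groundEnergySet_nonempty_model F ha hb⟩

end Summit.Ventures.CertifiedQuantumChemistry.Runbook
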